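import Mathlib.RingTheory.PowerSeries.WeierstrassPreparation
import Mathlib.Analysis.Normed.Field.Basic
import Mathlib.Algebra.Order.BigOperators.Ring.Finset
import HarnessLib

/-!
# Weierstrass factorization and roots: `∏_{u ≠ 0} ‖u‖ = ‖[X¹]g‖` for a power series with `deg`-many distinct roots

Topic `Literature/RingTheory/PowerSeries`; THEOREMS ONLY. Let `A` be a local ring, `g ∈ A⟦X⟧` with a Weierstrass factorization
`g = f·h` (`f` distinguished of degree `n`, `h` a unit; Mathlib `PowerSeries.IsWeierstrassFactorization`, Washington Thm. 7.3) and
`g(0) = 0`, and let `ι : A → K` be a ring map into a field. If `S ⊂ K` is a set of `n` DISTINCT roots of `f` (read in `K`) containing `0`,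
then `f = ∏_{s ∈ S}(X − s)` in `K[X]` and

* `map_eq_prod_X_sub_C_of_card_eq` — `f.map ι = ∏_{s∈S} (X − C s)`;
* `coeff_one_eq_mul_prod_of_card_eq` — `ι([X¹]g) = ι(h(0)) · ∏_{s ∈ S ∖ 0} (−s)`;
* (normed `K`, `‖ι(a)‖ ≤ 1` on `A`) `prod_norm_eq_norm_coeff_one` — **`∏_{s ∈ S∖0} ‖s‖ = ‖ι([X¹]g)‖`** (units of `A` have norm `1`), and
  `exists_norm_coeff_one_le_norm_pow` — **some `s ∈ S ∖ 0` has `‖ι([X¹]g)‖ ≤ ‖s‖^{n−1}`**.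

Use (BSD route EdixhovenFibreFiveSeven, crux K★, road item (R1), memo `Lines/kato-lever-hDR-R1-torsion-witness.md`): `g = [p]_{W′}` the
multiplication-by-`p` series of the good model of a potentially supersingular cell over the RAMIFIED ring `𝒪_{F′}`, `n = p²`, `S` = the
`z`-coordinates of `E[p] ⊂ Ŵ′(𝔪_ℂ)`, `[X¹]g = p`: some `p`-torsion point has `‖u‖^{p²−1} ≥ ‖p‖`, hence lies outside the canonical
subgroup (`‖p‖ < ‖u‖^p`) — the point witness of the η-transversality that does NOT follow from "`[p] ≡ 0 mod (p, X^{p²})`" over a ramified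
base. Nothing about elliptic curves is proved here.

## References
* L. C. Washington, *Introduction to Cyclotomic Fields*, 2nd ed. (1997), Thm. 7.3 (Weierstrass preparation). [Washington1997]
* J.-P. Serre, *Propriétés galoisiennes des points d'ordre fini des courbes elliptiques* (1972), §1.11 (valuations of torsion points). [Serre1972]
-/

noncomputable section

open scoped Classical
open Polynomial

namespace Literature.RingTheory.PowerSeries

section Algebra

variable {A K : Type*} [CommRing A] [IsLocalRing A] [Field K] (ι : A →+* K)
  {g : PowerSeries A} {f : A[X]} {h : PowerSeries A}

/-- **A monic polynomial with `deg`-many distinct roots in a field is their product**: if `f` is distinguished of degree `n` and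
`S ⊂ K` consists of `n` distinct roots of `f.map ι`, then `f.map ι = ∏_{s∈S}(X − C s)`. [cite: Washington1997, Thm. 7.3] -/
theorem map_eq_prod_X_sub_C_of_card_eq (H : g.IsWeierstrassFactorization f h) (S : Finset K)
    (hcard : S.card = f.natDegree) (hroots : ∀ s ∈ S, (f.map ι).IsRoot s) :
    f.map ι = ∏ s ∈ S, (X - C s) := by
  have hmonic : (f.map ι).Monic := H.isDistinguishedAt.monic.map ι
  have hne : f.map ι ≠ 0 := hmonic.ne_zero
  have hdeg : (f.map ι).natDegree = S.card := by rw [H.isDistinguishedAt.monic.natDegree_map, hcard]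
  -- `S ≤ roots` as multisets, with equal cardinality
  have hle : S.val ≤ (f.map ι).roots := by
    rw [Multiset.le_iff_subset S.nodup]
    intro s hs
    exact (mem_roots hne).mpr (hroots s hs)
  have hrootscard : Multiset.card (f.map ι).roots = (f.map ι).natDegree := by
    refine le_antisymm (card_roots' _) ?_
    rw [hdeg]
    exact Multiset.card_le_card hle
  have hrootseq : (f.map ι).roots = S.val :=
    (Multiset.eq_of_le_of_card_le hle (by rw [hrootscard, hdeg]; rfl)).symm
  rw [← prod_multiset_X_sub_C_of_monic_of_roots_card_eq hmonic hrootscard, hrootseq]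
  rfl

/-- `f(0) = 0` when `g(0) = 0` (`h(0)` is a unit of the local ring `A`). [cite: Washington1997, Thm. 7.3] -/
theorem coeff_zero_eq_zero_of_constantCoeff_eq_zero (H : g.IsWeierstrassFactorization f h)
    (hg0 : PowerSeries.constantCoeff g = 0) : f.coeff 0 = 0 := by
  have hh0 : IsUnit (PowerSeries.constantCoeff h) := PowerSeries.isUnit_constantCoeff h H.isUnit
  have h1 : PowerSeries.constantCoeff g = f.coeff 0 * PowerSeries.constantCoeff h := by
    rw [H.eq_mul, map_mul, ← PowerSeries.coeff_zero_eq_constantCoeff_apply, Polynomial.coeff_coe]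
  rw [hg0] at h1
  exact (hh0.mul_left_eq_zero).mp h1.symm

/-- **`[X¹]g = [X¹]f · h(0)`** when `g(0) = 0`. [cite: Washington1997, Thm. 7.3] -/
theorem coeff_one_eq_coeff_one_mul (H : g.IsWeierstrassFactorization f h) (hg0 : PowerSeries.constantCoeff g = 0) :
    PowerSeries.coeff 1 g = f.coeff 1 * PowerSeries.constantCoeff h := by
  rw [H.eq_mul, PowerSeries.coeff_mul, Finset.Nat.antidiagonal_succ, Finset.sum_cons, Finset.Nat.antidiagonal_zero,
    Finset.map_singleton, Finset.sum_singleton]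
  simp only [Function.Embedding.coe_prodMap, Function.Embedding.coeFn_mk, Prod.map_apply, Nat.succ_eq_add_one, zero_add,
    Function.Embedding.refl_apply, PowerSeries.coeff_zero_eq_constantCoeff, Polynomial.coeff_coe]
  rw [coeff_zero_eq_zero_of_constantCoeff_eq_zero H hg0, zero_mul, zero_add]

/-- **`ι([X¹]g) = ι(h(0)) · ∏_{s ∈ S∖0}(−s)`**: with `0 ∈ S`, `f = X·∏_{s≠0}(X − s)` in `K[X]`, whose `X¹`-coefficient is `∏(−s)`.
[cite: Washington1997, Thm. 7.3] -/
theorem coeff_one_eq_mul_prod_of_card_eq (H : g.IsWeierstrassFactorization f h) (hg0 : PowerSeries.constantCoeff g = 0)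
    (S : Finset K) (hS0 : (0 : K) ∈ S) (hcard : S.card = f.natDegree) (hroots : ∀ s ∈ S, (f.map ι).IsRoot s) :
    ι (PowerSeries.coeff 1 g) = ι (PowerSeries.constantCoeff h) * ∏ s ∈ S.erase 0, (-s) := by
  have hprod := map_eq_prod_X_sub_C_of_card_eq ι H S hcard hroots
  rw [← Finset.mul_prod_erase S _ hS0, map_zero, sub_zero] at hprod
  have h1 : ι (f.coeff 1) = ∏ s ∈ S.erase 0, (-s) := by
    rw [← Polynomial.coeff_map, hprod, Polynomial.coeff_X_mul, Polynomial.coeff_zero_eq_eval_zero, Polynomial.eval_prod]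
    simp only [eval_sub, eval_X, eval_C, zero_sub]
  rw [coeff_one_eq_coeff_one_mul H hg0, map_mul, h1, mul_comm]

end Algebra

section Norm

variable {A K : Type*} [CommRing A] [IsLocalRing A] [NormedField K] (ι : A →+* K) (hι : ∀ a, ‖ι a‖ ≤ 1)
  {g : PowerSeries A} {f : A[X]} {h : PowerSeries A}

omit [IsLocalRing A] in
include hι in
/-- Units of `A` map to elements of norm `1` (`‖ι u‖ ≤ 1`, `‖ι u⁻¹‖ ≤ 1`, product `1`). [folklore] -/
private theorem norm_map_eq_one_of_isUnit {a : A} (ha : IsUnit a) : ‖ι a‖ = 1 := by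
  obtain ⟨u, rfl⟩ := ha
  have h1 : ‖ι (u : A)‖ * ‖ι (↑u⁻¹ : A)‖ = 1 := by rw [← norm_mul, ← map_mul, Units.mul_inv, map_one, norm_one]
  have ha := hι (u : A)
  have hb := hι (↑u⁻¹ : A)
  nlinarith [norm_nonneg (ι (u : A)), norm_nonneg (ι (↑u⁻¹ : A))]

include hι in
/-- **`∏_{s ∈ S∖0} ‖s‖ = ‖ι([X¹]g)‖`**: the product of the norms of the non-zero roots of a power series with Weierstrass
factorization `g = f·h`, `g(0) = 0`, over the `deg f` distinct roots `S ∋ 0` of `f` in `K` (`‖ι(A)‖ ≤ 1`, so units of `A` have norm `1`).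
[cite: Washington1997, Thm. 7.3] -/
theorem prod_norm_eq_norm_coeff_one (H : g.IsWeierstrassFactorization f h) (hg0 : PowerSeries.constantCoeff g = 0)
    (S : Finset K) (hS0 : (0 : K) ∈ S) (hcard : S.card = f.natDegree) (hroots : ∀ s ∈ S, (f.map ι).IsRoot s) :
    ∏ s ∈ S.erase 0, ‖s‖ = ‖ι (PowerSeries.coeff 1 g)‖ := by
  rw [coeff_one_eq_mul_prod_of_card_eq ι H hg0 S hS0 hcard hroots, norm_mul,
    norm_map_eq_one_of_isUnit ι hι (PowerSeries.isUnit_constantCoeff h H.isUnit), one_mul, norm_prod]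
  exact Finset.prod_congr rfl fun s _ => (norm_neg s).symm

include hι in
/-- **Some non-zero root is large: `‖ι([X¹]g)‖ ≤ ‖s‖^{n−1}`** for some `s ∈ S ∖ 0` (`n = deg f = #S ≥ 2`), since the product of the
`n − 1` norms is `‖ι([X¹]g)‖` and each factor is at most the largest one. [cite: Washington1997, Thm. 7.3] -/
theorem exists_norm_coeff_one_le_norm_pow (H : g.IsWeierstrassFactorization f h) (hg0 : PowerSeries.constantCoeff g = 0)
    (S : Finset K) (hS0 : (0 : K) ∈ S) (hcard : S.card = f.natDegree) (hroots : ∀ s ∈ S, (f.map ι).IsRoot s)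
    (hn : 2 ≤ f.natDegree) :
    ∃ s ∈ S.erase 0, ‖ι (PowerSeries.coeff 1 g)‖ ≤ ‖s‖ ^ (f.natDegree - 1) := by
  have hne : (S.erase 0).Nonempty := by
    rw [← Finset.card_pos, Finset.card_erase_of_mem hS0, hcard]
    omega
  obtain ⟨s, hs, hmax⟩ := Finset.exists_max_image (S.erase 0) (fun s => ‖s‖) hne
  refine ⟨s, hs, ?_⟩
  rw [← prod_norm_eq_norm_coeff_one ι hι H hg0 S hS0 hcard hroots, ← hcard, ← Finset.card_erase_of_mem hS0,
    ← Finset.prod_const]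
  exact Finset.prod_le_prod (fun _ _ => norm_nonneg _) hmax

end Norm

end Literature.RingTheory.PowerSeries

end
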